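import Summits.Ventures.PercRepro.Night2NonFatColoop
import Summits.Ventures.PercRepro.Night2FatXUnloaded

/-!
# night-2: the NON-FAT case of (FAIR) — the smallest cell `|G| = 10` is closed (gen 37)

A basis pair `(B, z)` has `N = |G ∖ Q| ≥ 4` (`four_le_card_sdiff_insert`: `W ∪ {z}` spans the rank-`5` set `G ∖ K`).
At the bottom `N = 4` every point `y ∈ W` is a coloop point (`W ∖ {y}` has three points, rank `≤ 3`), so by the coloop
theorem of `Night2NonFatColoop` every level-1 target carries `vCap = 1` against a face sum `≤ (2/9) · C(6, 2) = 10/3`: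
four terms `≥ 3/10` give `6/5 ≥ 1` (`basis_pair_fair_of_card_sdiff_eq_four`).  Hence the cell `(2, 1)` with NO fat closure
and `|G| = 10` satisfies the local Hall inequality (`localShadowHall_nonfat_of_card_eq_ten`) — the first closed sub-case of the
non-fat case of h21 (with `localShadowHall_fat`, gen 36, and `localShadowHall_two_one_five_fatClosures_free`, gen 28, this
settles h21's cell at `|G| = 10` outright: `localShadowHall_two_one_of_card_eq_ten` in `Night2NonFatTen`).
Paper: proofs/NIGHT-2-g37.md §3.
-/

namespace PercRepro.Shadow

open PercRepro.ThmH PercRepro.PerFlat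

variable {α : Type*} [DecidableEq α] {M : Matroid α} [M.Finite] {G : Finset α}

/-- With `N = 4` every point of `W` is a coloop point: `W ∖ {y}` has three points. -/
theorem rkN_erase_le_three_of_card_eq_four {W : Finset α} (h4 : W.card = 4) {y : α} (hy : y ∈ W) :
    rkN M (W.erase y) ≤ 3 := by
  have := rkN_le_card (M := M) (W.erase y)
  rw [Finset.card_erase_of_mem hy, h4] at this
  exact this

/-- **The fair share of every lossy basis pair with `N = 4`** (no fat closure): the four level-1 terms are `≥ 3/10`. -/
theorem basis_pair_fair_of_card_sdiff_eq_four (hG : G ∈ flatsQ M (5 + 1)) (hd : (gr M \ G).card = 2)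
    (hk : kColoops M G = 1) (hs : ∀ e ∈ gr M, ∀ f ∈ gr M, e ≠ f → rkN M {e, f} = 2)
    (hl : ∀ e ∈ gr M, M.Indep {e}) (hnf : fatClosures M 5 G 2 = ∅) {B : Finset α}
    (hB : B ∈ thinMembers M 5 G) (hnP : ¬ bigP M G B) {z : α} (hz : z ∈ G \ clF M B)
    (hl0 : loss M 5 G B z ≠ 0) (h4 : (G \ insert z B).card = 4) :
    loss M 5 G B z ≤ rhoL M 5 G B z * lossIncomeH M 5 G (bigP M G) (dshGT2 M 5 G) B z := by
  apply basis_pair_fair_of_coloop_sum hG hd hk hs hl hnf hB hnP hz hl0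
  have hfilt : (G \ insert z B).filter (fun y => rkN M ((G \ insert z B).erase y) ≤ 3) = G \ insert z B :=
    Finset.filter_true_of_mem (fun y hy => rkN_erase_le_three_of_card_eq_four (M := M) h4 hy)
  rw [hfilt]
  have hterm : ∀ y ∈ G \ insert z B, (3 / 10 : ℚ) ≤
      9 / (2 * (((((insert y (insert z B) \ coloops M G) \ clF M ((G \ insert z B).erase y)).card).choose 2 : ℕ) : ℚ)) := by
    intro y hy
    have hr := rkN_erase_le_three_of_card_eq_four (M := M) h4 hy
    have h6 := card_insert_sdiff_coloops_eq_six hG hd hk hB hnP hz hy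
    have hs6 : ((insert y (insert z B) \ coloops M G) \ clF M ((G \ insert z B).erase y)).card ≤ 6 := by
      rw [← h6]
      exact Finset.card_le_card Finset.sdiff_subset
    have hch : (((insert y (insert z B) \ coloops M G) \ clF M ((G \ insert z B).erase y)).card).choose 2 ≤ 15 := by
      calc (((insert y (insert z B) \ coloops M G) \ clF M ((G \ insert z B).erase y)).card).choose 2
          ≤ Nat.choose 6 2 := Nat.choose_le_choose 2 hs6
        _ = 15 := by decide
    have hch' : ((((insert y (insert z B) \ coloops M G) \ clF M ((G \ insert z B).erase y)).card.choose 2 : ℕ) : ℚ)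
        ≤ 15 := by exact_mod_cast hch
    have hpos := faceSum_pos_of_mem_tgtSets hG hd hk hB hnP hz hl0
      (level_one_targets_subset hG hB hz (Finset.mem_image.2 ⟨y, hy, rfl⟩))
    have hle := faceSum_insert_le_choose hG hd hk hnf hB hnP hz hy hr
    have hcpos : (0 : ℚ) <
        ((((insert y (insert z B) \ coloops M G) \ clF M ((G \ insert z B).erase y)).card.choose 2 : ℕ) : ℚ) := by
      by_contra h
      rw [not_lt] at h
      linarith
    rw [div_le_div_iff₀ (by norm_num) (by linarith)]
    linarith
  calc (1 : ℚ) ≤ ((G \ insert z B).card : ℚ) * (3 / 10) := by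
        rw [h4]
        norm_num
    _ = ∑ _y ∈ G \ insert z B, (3 / 10 : ℚ) := by
        rw [Finset.sum_const, nsmul_eq_mul]
    _ ≤ ∑ y ∈ G \ insert z B,
        9 / (2 * (((((insert y (insert z B) \ coloops M G) \ clF M ((G \ insert z B).erase y)).card).choose 2 : ℕ) : ℚ)) :=
        Finset.sum_le_sum hterm

/-- A basis pair of the cell has `|G ∖ Q| = |G| − 6`. -/
theorem card_sdiff_insert_eq_card_sub_six (hG : G ∈ flatsQ M (5 + 1)) (hd : (gr M \ G).card = 2)
    (hk : kColoops M G = 1) {B : Finset α} (hB : B ∈ thinMembers M 5 G) (hnP : ¬ bigP M G B) {z : α}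
    (hz : z ∈ G \ clF M B) : (G \ insert z B).card = G.card - 6 := by
  have hd' : (gr M \ G).card ≤ 5 := by omega
  have h4 := card_sdiff_eq_four_of_not_bigP hG hd hk hB hnP
  have hKB : coloops M G ⊆ B := coloops_subset_of_mem_thinMembers hG hd' hB
  have hBG : B ⊆ G := subset_G_of_mem_thinMembers hB
  have hzB : z ∉ B := fun h => (Finset.mem_sdiff.1 hz).2
    (subset_clF_of_subset_gr (hBG.trans (mem_flatsQ.1 hG).1) h)
  have hQG : insert z B ⊆ G := Finset.insert_subset (Finset.mem_sdiff.1 hz).1 hBG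
  have hBcard : B.card = 5 := by
    have h1 := Finset.card_sdiff_add_card_eq_card hKB
    rw [← kColoops_eq_card_coloops, hk, h4] at h1
    omega
  rw [Finset.card_sdiff_of_subset hQG, Finset.card_insert_of_notMem hzB, hBcard]

/-- **The cell `(2, 1)` with no fat closure and `|G| = 10` satisfies the local Hall inequality.** -/
theorem localShadowHall_nonfat_of_card_eq_ten (hG : G ∈ flatsQ M (5 + 1)) (hd : (gr M \ G).card = 2)
    (hk : kColoops M G = 1) (hs : ∀ e ∈ gr M, ∀ f ∈ gr M, e ≠ f → rkN M {e, f} = 2)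
    (hl : ∀ e ∈ gr M, M.Indep {e}) (hnf : fatClosures M 5 G 2 = ∅) (h10 : G.card = 10) :
    LocalShadowHall M 5 G := by
  have hfat : (fatClosures M 5 G 2).card ≤ 1 := by
    rw [hnf, Finset.card_empty]
    exact zero_le_one
  apply localShadowHall_of_gt2_of_basis_fair hG hd hk hs hl hfat
  intro B hB hnP z hz
  by_cases hl0 : loss M 5 G B z = 0
  · rw [hl0]
    have hd' : (gr M \ G).card ≤ 5 := by omega
    have h1 : 0 ≤ rhoL M 5 G B z := by
      unfold rhoL
      rw [hl0]
      simp
    have h2 : 0 ≤ lossIncomeH M 5 G (bigP M G) (dshGT2 M 5 G) B z :=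
      lossIncomeH_nonneg hG hd' (column_side_gt2 hG hd hk hs hl hfat) B z
    positivity
  · apply basis_pair_fair_of_card_sdiff_eq_four hG hd hk hs hl hnf hB hnP hz hl0
    rw [card_sdiff_insert_eq_card_sub_six hG hd hk hB hnP hz, h10]

end PercRepro.Shadow
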